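import Summits.KontsevichZagierPeriods.KontsevichZagierPeriods.Theorems.RootDecompOrderCutAdicStagesP2

/-! # `RootDecompOrderCutAdicStagesP3` — part 3/5 of the mechanical ≤350-line split of `src.lean`
(split by the decomp-kz census seat for landing; mathematics unchanged; part 3 continues part 2). -/

noncomputable section
open Literature.NumberTheory.Transcendental Literature.NumberTheory.Transcendental.KZ
open Summit.KontsevichZagierPeriods.KontsevichZagierPeriods.Theses
open Summit.KontsevichZagierPeriods.RootDecompPureDefect
open Summit.KontsevichZagierPeriods.RootDecompOrderCut
open Polynomial

namespace Summit.KontsevichZagierPeriods.RootDecompAdicStages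

/-- `AdicSeparated` kills every flat defect: `AdicSeparated ∧ FlatDefect ⟹ S` is the special case `i = x·h`. -/
theorem summit_of_flat_of_adicSeparated (hF : FlatDefect) (hS : AdicSeparated) : _root_.KontsevichZagierPeriods :=
  closes_adic (adicDefect_of_flatDefect hF) hS

/-- **`ProperCone` ALONE makes adic kernels square-zero**: under 31891 every class fixed by a defect has `x² = 0`
(so `ProperCone ∧ AdicDefect ⟹` every defect is square-zero, and `Reduced` finishes: a second proof of
`AdicDefect → ProperCone → Reduced → S`, weaker than route O's `closes` since `AdicDefect ⟹ DN`). -/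
theorem sq_eq_zero_of_fix_of_properCone (hP : RootDecompOrderCut.ProperCone) {x i : FormalPeriodRing}
    (hi : evalP i = 0) (hix : i * x = x) : x * x = 0 := by
  have h := sq_mem_supp_of_torsionOne (m := 1 - i) (x := x) (by rw [map_sub, map_one, hi, sub_zero])
    (by rw [sub_mul, one_mul, hix, sub_self])
  exact (properCone_iff_posCone.mp hP) _ h.1 h.2

/-- Auxiliary step `sq_eq_zero_of_adicKernel_of_properCone`. [bookkeeping] -/
theorem sq_eq_zero_of_adicKernel_of_properCone (hP : RootDecompOrderCut.ProperCone) (A : Subring FormalPeriodRing)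
    [IsNoetherianRing A] (x : A) (hx : ∀ n : ℕ, x ∈ stageIdeal A ^ n) : (x : FormalPeriodRing) * x = 0 := by
  obtain ⟨i, hi, hix⟩ := (mem_adicKernel_iff A x).mp hx
  exact sq_eq_zero_of_fix_of_properCone hP hi (by rw [← Subring.coe_mul, hix])

/-- Auxiliary step `closes_adic_order`. [bookkeeping] -/
theorem closes_adic_order (hD : AdicDefect) (hP : RootDecompOrderCut.ProperCone) (hR : RootDecompOrderCut.ReducedPeriodRing) :
    _root_.KontsevichZagierPeriods :=
  closes_adic hD (adicSeparated_of_order hP hR)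

/-- **THE EXCHANGE LATTICE** (all edges by name; the three exact diagonals). -/
theorem exchange_lattice :
    (FlatDefect → AdicDefect) ∧ (AdicDefect → LocTriv) ∧ (RootDecompPureDefect.PiFlatDefect → LocTriv) ∧
    (PiPowerDefect → LocTriv) ∧ (LocTriv → RootDecompOrderCut.DefectNegligible) ∧ (AdicDefect → KernelIdempotent) ∧
    (RootDecompOrderCut.ProperCone → RootDecompOrderCut.ReducedPeriodRing → Cancellation) ∧ (Cancellation → AdicSeparated) ∧
    (KrullSeparated → AdicSeparated) ∧ (AdicSeparated → Connected) ∧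
    (_root_.KontsevichZagierPeriods ↔ AdicDefect ∧ AdicSeparated) ∧
    (_root_.KontsevichZagierPeriods ↔ LocTriv ∧ Cancellation) ∧
    (_root_.KontsevichZagierPeriods ↔
      RootDecompOrderCut.DefectNegligible ∧ RootDecompOrderCut.ProperCone ∧ RootDecompOrderCut.ReducedPeriodRing) :=
  ⟨adicDefect_of_flatDefect, locTriv_of_adicDefect, locTriv_of_piFlatDefect, locTriv_of_piPowerDefect,
    defectNegligible_of_locTriv, kernelIdempotent_of_adicDefect, cancellation_of_order', adicSeparated_of_cancellation,
    adicSeparated_of_krullSeparated, connected_of_adicSeparated, summit_iff_adic, summit_iff_locTriv_cancellation,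
    summit_iff_orderCut⟩

/-! ## 7. Interface models: independence and the non-exact mixed pairs

Six commutative rings with a real character `v` (and a disc class `ϖ` with `v ϖ = π` where relevant):
* `ℝ[X]`, `v = ev₀`                                     ⊨ `AdicSeparated ∧ Cancellation ∧ ¬LocTriv ∧ ¬AdicDefect ∧ ¬S`;
* `ℝ × ℝ`, `v = pr₁`, `ϖ = (π, π)`                      ⊨ `FlatDefect ∧ AdicDefect ∧ LocTriv ∧ ¬AdicSeparated ∧ ¬Connected ∧ ¬0541 ∧ ¬S`;
* `𝔛 = ℚ[X] ×_ℚ ℚ[X]` (two lines crossing), `v = a(π)`, `ϖ = (X, X)`: the FREE STAGE of an equal-value quadratic pair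
  `g = (X, −X)`, `g² = ϖ²`, `v g = v ϖ`                  ⊨ `LocTriv ∧ AdicSeparated ∧ ¬AdicDefect ∧ ¬Cancellation ∧ ¬27508 ∧ ¬27509 ∧ ¬S`;
* `𝔑 = ℚ[X] ×_ℚ ℚ[ε]/(ε²)`, `v = a(π)`, `ϖ = (X, 0)` (torsion phantom)
                                                        ⊨ `0541 ∧ 27508 ∧ 27509 ∧ LocTriv ∧ AdicSeparated ∧ ¬AdicDefect ∧ ¬Cancellation ∧ ¬S`;
* `𝔜 = ℝ[X] ×_{X=1 ↔ Y=0} ℝ[Y]` (hinge), `v = f(0)`     ⊨ `Connected ∧ ¬AdicSeparated ∧ ¬S`;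
* `𝔓 = ℚ[x^{ℚ≥0}]` (Puiseux polynomials), `v =` const. term ⊨ `KernelIdempotent ∧ AdicSeparated ∧ ¬Krull ∧ ¬AdicDefect ∧ ¬S`
  (the exchange `(KernelIdempotent, Krull) ⟶ (AdicDefect, AdicSeparated)` is forced: `KernelIdempotent ∧ AdicSeparated ⇏ S`).
-/

namespace Iface

/-! ### `ℝ[X]`, `v = ev₀` -/

/-- The character `p ↦ p(0)` of `ℝ[X]`. -/
def vPoly : ℝ[X] →+* ℝ := Polynomial.evalRingHom 0

/-- Auxiliary step `vPoly_apply`. [bookkeeping] -/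
theorem vPoly_apply (p : ℝ[X]) : vPoly p = p.eval 0 := rfl

/-- Auxiliary step `vPoly_X`. [bookkeeping] -/
theorem vPoly_X : vPoly X = 0 := by rw [vPoly_apply, Polynomial.eval_X]

/-- Auxiliary step `modelPoly_adicSeparated`. [bookkeeping] -/
theorem modelPoly_adicSeparated : AdicSeparatedI vPoly := by
  intro x i hi hix
  have h : (1 - i) * x = 0 := by rw [sub_mul, one_mul, hix, sub_self]
  rcases mul_eq_zero.mp h with h1 | h1
  · exfalso
    have h2 := congrArg vPoly h1
    rw [map_sub, map_one, hi, sub_zero, map_zero] at h2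
    exact one_ne_zero h2
  · exact h1

/-- Auxiliary step `modelPoly_cancellation`. [bookkeeping] -/
theorem modelPoly_cancellation : CancellationI vPoly := by
  intro g x hg hgx
  rcases mul_eq_zero.mp hgx with h | h
  · exact absurd (by rw [h, map_zero]) hg
  · exact h

/-- Auxiliary step `modelPoly_not_locTriv`. [bookkeeping] -/
theorem modelPoly_not_locTriv : ¬ LocTrivI vPoly := by
  intro h
  obtain ⟨s, hs, hsX⟩ := h X vPoly_X
  rcases mul_eq_zero.mp hsX with h1 | h1
  · exact hs (by rw [h1, map_zero])
  · exact X_ne_zero h1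

/-- Auxiliary step `modelPoly_not_adicDefect`. [bookkeeping] -/
theorem modelPoly_not_adicDefect : ¬ AdicDefectI vPoly := fun h => modelPoly_not_locTriv (locTriv_of_adicDefect h)

/-- Auxiliary step `modelPoly_not_s`. [bookkeeping] -/
theorem modelPoly_not_s : ¬ SI vPoly := fun h => X_ne_zero (h X vPoly_X)

/-! ### `ℝ × ℝ`, `v = pr₁`, `ϖ = (π, π)` -/

/-- The character `pr₁` of `ℝ × ℝ`. -/
def vPair : ℝ × ℝ →+* ℝ := RingHom.fst ℝ ℝ

/-- Auxiliary step `vPair_apply`. [bookkeeping] -/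
theorem vPair_apply (z : ℝ × ℝ) : vPair z = z.1 := rfl

/-- Auxiliary step `modelPair_flatDefect`. [bookkeeping] -/
theorem modelPair_flatDefect : FlatDefectI vPair := by
  rintro ⟨a, b⟩ hx
  have ha : a = 0 := hx
  subst ha
  by_cases hb : b = 0
  · subst hb; exact ⟨0, by simp⟩
  · exact ⟨(0, b⁻¹), by ext <;> simp [hb]⟩

/-- Auxiliary step `modelPair_adicDefect`. [bookkeeping] -/
theorem modelPair_adicDefect : AdicDefectI vPair := adicDefect_of_flat modelPair_flatDefect

/-- Auxiliary step `modelPair_locTriv`. [bookkeeping] -/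
theorem modelPair_locTriv : LocTrivI vPair := locTriv_of_adicDefect modelPair_adicDefect

/-- Auxiliary step `modelPair_kernelIdempotent`. [bookkeeping] -/
theorem modelPair_kernelIdempotent : KernelIdempotentI vPair := kernelIdempotent_of_adicDefect modelPair_adicDefect

/-- Auxiliary step `modelPair_not_adicSeparated`. [bookkeeping] -/
theorem modelPair_not_adicSeparated : ¬ AdicSeparatedI vPair := by
  intro h
  have h1 := h (0, 1) (0, 1) rfl (by ext <;> simp)
  exact one_ne_zero (congrArg Prod.snd h1)

/-- Auxiliary step `modelPair_not_connected`. [bookkeeping] -/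
theorem modelPair_not_connected : ¬ ConnectedI vPair := by
  intro h
  have h1 := h (0, 1) (by change ((0 : ℝ), (1 : ℝ)) * (0, 1) = (0, 1); ext <;> simp) rfl
  exact one_ne_zero (congrArg Prod.snd h1)

/-- Auxiliary step `modelPair_not_piPower`. [bookkeeping] -/
theorem modelPair_not_piPower : ¬ PiPowerDefectI vPair (Real.pi, Real.pi) := by
  intro h
  obtain ⟨N, hN⟩ := h (0, 1) rfl
  have h1 := congrArg Prod.snd hN
  rw [Prod.snd_mul, Prod.pow_snd, Prod.snd_zero, mul_one] at h1
  exact pow_ne_zero N Real.pi_ne_zero h1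

/-- Auxiliary step `modelPair_not_s`. [bookkeeping] -/
theorem modelPair_not_s : ¬ SI vPair := fun h => one_ne_zero (congrArg Prod.snd (h (0, 1) rfl))

/-! ### `𝔛` — the free stage of an equal-value quadratic pair (two lines crossing at the period point) -/

/-- LINDEMANN for rational polynomials (tree `transcendental_pi_holds`). -/
theorem aeval_pi_eq_zero_imp {p : ℚ[X]} (h : Polynomial.aeval Real.pi p = 0) : p = 0 := by
  by_contra hp
  exact transcendental_pi_holds ⟨p, hp, h⟩

/-- carrier of `𝔛`: pairs `(a, b) ∈ ℚ[X] × ℚ[X]` with `a(0) = b(0)`. -/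
def crossCarrier : Subring (ℚ[X] × ℚ[X]) :=
  RingHom.eqLocus ((Polynomial.evalRingHom 0).comp (RingHom.fst ℚ[X] ℚ[X]))
    ((Polynomial.evalRingHom 0).comp (RingHom.snd ℚ[X] ℚ[X]))

/-- Membership in `crossCarrier`, unfolded. [bookkeeping] -/
theorem mem_crossCarrier {z : ℚ[X] × ℚ[X]} : z ∈ crossCarrier ↔ z.1.eval 0 = z.2.eval 0 := Iff.rfl

/-- value map of `𝔛`: `(a, b) ↦ a(π)` (the branch on which the pair identity holds). -/
def vCross : crossCarrier →+* ℝ :=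
  (Polynomial.aeval Real.pi).toRingHom.comp ((RingHom.fst ℚ[X] ℚ[X]).comp crossCarrier.subtype)

/-- Auxiliary step `vCross_apply`. [bookkeeping] -/
theorem vCross_apply (z : crossCarrier) : vCross z = Polynomial.aeval Real.pi z.1.1 := rfl

/-- disc class `ϖ = (X, X)`. -/
def piCross : crossCarrier := ⟨(X, X), by rw [mem_crossCarrier]⟩
/-- the partner `g = (X, −X)` (`g² = ϖ²`, `v g = v ϖ`, `g ≠ ϖ`). -/
def gCross : crossCarrier := ⟨(X, -X), by rw [mem_crossCarrier]; simp⟩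
/-- a multiplier of value `π` killing the phantom branch: `s = (X, 0)`. -/
def sCross : crossCarrier := ⟨(X, 0), by rw [mem_crossCarrier]; simp⟩
/-- the phantom defect `d = (0, X)` (`= (ϖ − g)/2`). -/
def dCross : crossCarrier := ⟨(0, X), by rw [mem_crossCarrier]; simp⟩
/-- a defect violating 27508: `e = (0, X + X²)`. -/
def eCross : crossCarrier := ⟨(0, X + X * X), by rw [mem_crossCarrier]; simp⟩

/-- Auxiliary step `coe_piCross`. [bookkeeping] -/
@[simp] theorem coe_piCross : (piCross : ℚ[X] × ℚ[X]) = (X, X) := rfl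
/-- Auxiliary step `coe_gCross`. [bookkeeping] -/
@[simp] theorem coe_gCross : (gCross : ℚ[X] × ℚ[X]) = (X, -X) := rfl
/-- Auxiliary step `coe_sCross`. [bookkeeping] -/
@[simp] theorem coe_sCross : (sCross : ℚ[X] × ℚ[X]) = (X, 0) := rfl
/-- Auxiliary step `coe_dCross`. [bookkeeping] -/
@[simp] theorem coe_dCross : (dCross : ℚ[X] × ℚ[X]) = (0, X) := rfl
/-- Auxiliary step `coe_eCross`. [bookkeeping] -/
@[simp] theorem coe_eCross : (eCross : ℚ[X] × ℚ[X]) = (0, X + X * X) := rfl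

/-- Auxiliary step `vCross_piCross`. [bookkeeping] -/
theorem vCross_piCross : vCross piCross = Real.pi := by
  rw [vCross_apply, coe_piCross]; exact aeval_X Real.pi

/-- Auxiliary step `vCross_gCross`. [bookkeeping] -/
theorem vCross_gCross : vCross gCross = Real.pi := by
  rw [vCross_apply, coe_gCross]; exact aeval_X Real.pi

/-- Auxiliary step `vCross_sCross`. [bookkeeping] -/
theorem vCross_sCross : vCross sCross = Real.pi := by
  rw [vCross_apply, coe_sCross]; exact aeval_X Real.pi

/-- Auxiliary step `vCross_dCross`. [bookkeeping] -/
theorem vCross_dCross : vCross dCross = 0 := by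
  rw [vCross_apply, coe_dCross]; exact map_zero _

/-- Auxiliary step `vCross_eCross`. [bookkeeping] -/
theorem vCross_eCross : vCross eCross = 0 := by
  rw [vCross_apply, coe_eCross]; exact map_zero _

/-- `g² = ϖ²` and `g ≠ ϖ`: `𝔛` is generated by an UNDECIDED equal-value quadratic pair. -/
theorem gCross_sq : gCross * gCross = piCross * piCross ∧ gCross ≠ piCross := by
  refine ⟨Subtype.ext (by simp), fun h => ?_⟩
  have h1 := congrArg (fun z : crossCarrier => (z : ℚ[X] × ℚ[X]).2) h
  simp only [coe_gCross, coe_piCross] at h1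
  have h2 : (2 : ℚ[X]) * X = 0 := by linear_combination (-1 : ℚ[X]) * h1
  exact X_ne_zero ((mul_eq_zero.mp h2).resolve_left two_ne_zero)

/-- Kernel of `𝔛`: first coordinate `0` (Lindemann), second coordinate vanishing at `0`. -/
theorem cross_defect {z : crossCarrier} (hz : vCross z = 0) : (z : ℚ[X] × ℚ[X]).1 = 0 ∧ (z : ℚ[X] × ℚ[X]).2.eval 0 = 0 := by
  have h1 : (z : ℚ[X] × ℚ[X]).1 = 0 := aeval_pi_eq_zero_imp hz
  have h2 : (z : ℚ[X] × ℚ[X]).1.eval 0 = (z : ℚ[X] × ℚ[X]).2.eval 0 := mem_crossCarrier.mp z.2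
  exact ⟨h1, by rw [← h2, h1, Polynomial.eval_zero]⟩

/-- Auxiliary step `modelCross_locTriv`. [bookkeeping] -/
theorem modelCross_locTriv : LocTrivI vCross := by
  intro z hz
  obtain ⟨h1, -⟩ := cross_defect hz
  refine ⟨sCross, by rw [vCross_sCross]; exact Real.pi_ne_zero, Subtype.ext ?_⟩
  rw [Subring.coe_mul, coe_sCross, Subring.coe_zero, Prod.ext_iff]
  exact ⟨by rw [Prod.fst_mul, h1, mul_zero, Prod.fst_zero], by rw [Prod.snd_mul, zero_mul, Prod.snd_zero]⟩

/-- Auxiliary step `modelCross_adicSeparated`. [bookkeeping] -/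
theorem modelCross_adicSeparated : AdicSeparatedI vCross := by
  intro x i hi hix
  obtain ⟨hi1, hi2⟩ := cross_defect hi
  have hc := congrArg (fun z : crossCarrier => (z : ℚ[X] × ℚ[X])) hix
  simp only [Subring.coe_mul, Prod.ext_iff, Prod.fst_mul, Prod.snd_mul, hi1, zero_mul] at hc
  have hsnd : (1 - (i : ℚ[X] × ℚ[X]).2) * (x : ℚ[X] × ℚ[X]).2 = 0 := by
    rw [sub_mul, one_mul, hc.2, sub_self]
  rcases mul_eq_zero.mp hsnd with h | h
  · exfalso
    have h3 := congrArg (Polynomial.eval 0) h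
    rw [Polynomial.eval_sub, Polynomial.eval_one, hi2, sub_zero, Polynomial.eval_zero] at h3
    exact one_ne_zero h3
  · exact Subtype.ext (Prod.ext hc.1.symm h)

/-- Auxiliary step `modelCross_connected`. [bookkeeping] -/
theorem modelCross_connected : ConnectedI vCross := connected_of_adicSeparated modelCross_adicSeparated

/-- The phantom defect `d = (0, X)` is fixed by NO defect of `𝔛` (a fixing `i` would have `i₂ = 1`, `i₂(0) = 0`). -/
theorem dCross_not_fixed : ¬ ∃ i : crossCarrier, vCross i = 0 ∧ i * dCross = dCross := by
  rintro ⟨i, hi, hix⟩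
  obtain ⟨-, hi2⟩ := cross_defect hi
  have hc := congrArg (fun z : crossCarrier => (z : ℚ[X] × ℚ[X]).2) hix
  simp only [Subring.coe_mul, Prod.snd_mul, coe_dCross] at hc
  have h1 : (i : ℚ[X] × ℚ[X]).2 = 1 := mul_right_cancel₀ X_ne_zero (by rw [hc, one_mul])
  have h2 := congrArg (Polynomial.eval 0) h1
  rw [hi2, Polynomial.eval_one] at h2
  exact zero_ne_one h2

/-- Auxiliary step `modelCross_not_adicDefect`. [bookkeeping] -/
theorem modelCross_not_adicDefect : ¬ AdicDefectI vCross := fun h => dCross_not_fixed (h dCross vCross_dCross)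

/-- Auxiliary step `sCross_mul_dCross`. [bookkeeping] -/
theorem sCross_mul_dCross : sCross * dCross = 0 := Subtype.ext (by simp)

/-- Auxiliary step `dCross_ne_zero`. [bookkeeping] -/
theorem dCross_ne_zero : dCross ≠ 0 := fun h => by
  have h1 := congrArg (fun z : crossCarrier => (z : ℚ[X] × ℚ[X]).2) h
  simp only [coe_dCross, Subring.coe_zero, Prod.snd_zero] at h1
  exact X_ne_zero h1

/-- Auxiliary step `modelCross_not_cancellation`. [bookkeeping] -/
theorem modelCross_not_cancellation : ¬ CancellationI vCross := fun h =>
  dCross_ne_zero (h sCross dCross (by rw [vCross_sCross]; exact Real.pi_ne_zero) sCross_mul_dCross)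

/-- Auxiliary step `modelCross_not_s`. [bookkeeping] -/
theorem modelCross_not_s : ¬ SI vCross := fun h => dCross_ne_zero (h dCross vCross_dCross)

/-- `𝔛 ⊭ 27509`: `d² = ϖ·d`, `v d = 0`, but no power of `ϖ` kills `d` (the phantom branch `g = −ϖ`). -/
theorem modelCross_not_piConnected : ¬ PiConnectedI vCross piCross := by
  intro h
  obtain ⟨m, hm⟩ := h dCross ⟨1, Subtype.ext (by simp)⟩ vCross_dCross
  have h1 := congrArg (fun z : crossCarrier => (z : ℚ[X] × ℚ[X]).2) hm
  simp only [Subring.coe_mul, SubmonoidClass.coe_pow, coe_piCross, coe_dCross, Prod.snd_mul, Prod.pow_snd,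
    Subring.coe_zero, Prod.snd_zero] at h1
  exact X_ne_zero (pow_eq_zero_iff (n := m + 1) (Nat.succ_ne_zero m) |>.mp (by rw [pow_succ, h1]))

/-- `𝔛 ⊭ 0541`. -/
theorem modelCross_not_piPower : ¬ PiPowerDefectI vCross piCross := by
  intro h
  obtain ⟨N, hN⟩ := h dCross vCross_dCross
  have h1 := congrArg (fun z : crossCarrier => (z : ℚ[X] × ℚ[X]).2) hN
  simp only [Subring.coe_mul, SubmonoidClass.coe_pow, coe_piCross, coe_dCross, Prod.snd_mul, Prod.pow_snd,
    Subring.coe_zero, Prod.snd_zero] at h1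
  exact X_ne_zero (pow_eq_zero_iff (n := N + 1) (Nat.succ_ne_zero N) |>.mp (by rw [pow_succ, h1]))

end Iface
end Summit.KontsevichZagierPeriods.RootDecompAdicStages
end
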